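import Summits.ResolutionOfSingularities.ResolutionOfSingularities.Theorems.PurelyInseparableDim4ResConePowerChain
import Summits.ResolutionOfSingularities.ResolutionOfSingularities.Theorems.PurelyInseparableDim4ResConeSliceA
import HarnessLib
import HarnessLib.Audit.Tags

/-!
# Purely inseparable four-folds — SLICE B, the SATELLITE PAIR: at a satellite step two exceptional letters
# born in a row are both still present, with multiplicities `oₖ − p`, `oₖ₊₁ − p` (cell `res-dim4-pi`, K2(p)
# lane, brick (K12a))

[OURS · counted 0 · cell `res-dim4-pi` · K2(p) lane (holder res-dim4-p-12 g3, naming 23:35:55Z «p-1 takes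
K12»; slice-B architecture `SLICE-B-ARCH-g3.md` v1.1) · seat res-dim4-p-1 g3.]  Nothing here proves K2(p)
(= `RidgeBudget.NoAboveFloorTrap p p`, slice B OPEN), `NoIsolatedTrap p p` or resolution of singularities in
dimension ≥ 4 / characteristic `p`.  AI kernel work, weaker than expert review.

Along a witnessed `Step0 p` chain (`FreeTail.IsWitnessedChain p c j b`: `c (k+1)` is the point step of `c k`
in chart `j k` at the chart point `b k`) of isolated above-floor states, the boundary bookkeeping of ONE step
is `r_{k+1} = (r_k|_{b_k = 0}).update (j k) (oₖ − p)` (`…ResConeSliceA.step_r_univ'`, `oₖ = ord₀ F_k > p` by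
`…ResConeSatChain.chain_band`).  A SATELLITE step `k + 1` (`FreeTail.IsSatellite j b k`: another chart,
`x_{j k}` not translated) therefore KEEPS the letter born at step `k`:

* **`stretchBorn_pair_of_satellite`** (K12a) — at `c (k+2)` the two letters `j k ≠ j (k+1)` carry
  `r (j k) = oₖ − p` and `r (j (k+1)) = oₖ₊₁ − p`, with the «kept on the segment» predicates the (DL) ledger
  (K11, res-dim4-p-2 g3) reads; `satellite_pair_sum` — their sum is `oₖ + oₖ₊₁ − 2p`.
* `exists_satellite_ge` — by the free-tail theorem (`FreeTailProof.noIsolatedFreeTailAt_self`, res-dim4-p-5)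
  satellite steps occur beyond every index of an all-isolated witnessed chain, so such pairs occur
  infinitely often (`frequently_stretchBorn_pair`).

(K12b)/(K12c) — «`oₖ + oₖ₊₁ + 3 ≤ 3p` or the residual form lives on the two letters» via K11's
`stretch_no_heavy_pair` — follow in a sequel importing K11 when it lands.
[cite: HauserPerlega2019PRIMS, §2 (transform D' of D)] [cite: CossartJannsenSaito2020, Thm. 3.14]
bears_on: LADDER-RESOLUTION:D157-DOOR2 (res-dim4-pi · K2(p) lane · slice B · K12).  Supports
stmt-ResolutionOfSingularities-16155 (helper).
-/

set_option linter.dupNamespace false -- mandated namespace of this single-conjunct summit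

noncomputable section

namespace Summit.ResolutionOfSingularities.ResolutionOfSingularities.Theorems.PIDim4

namespace ResCone

open MvPolynomial Finset
open Literature.AlgebraicGeometry.Resolution
open Literature.AlgebraicGeometry.Resolution.CentreBlowup
open Literature.AlgebraicGeometry.Resolution.Hauser2010

variable {K : Type} [Field K]

/-- **(K12a) The satellite pair.**  On a witnessed `Step0 p` chain of isolated above-floor states, if step
`k + 1` is a SATELLITE w.r.t. the letter `j k` born at step `k` (chart `j (k+1) ≠ j k`, `b (k+1) (j k) = 0`),
then at `c (k+2)` BOTH new letters are present: `r (j k) = oₖ − p` (born at `k`, kept untranslated through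
step `k + 1`) and `r (j (k+1)) = oₖ₊₁ − p` (born at `k + 1`), `oₖ = ord₀ F_k`, `oₖ₊₁ = ord₀ F_{k+1}`, both `> p`;
the last two conjuncts are K11's «kept on the segment» predicates for `(j k, k)` and `(j (k+1), k+1)`.
[cite: HauserPerlega2019PRIMS, §2 (transform D' of D)] [folklore] -/
theorem stretchBorn_pair_of_satellite (p : ℕ) [Fact p.Prime] [DecidableEq K] {c : ℕ → State K}
    {j : ℕ → Fin 4} {b : ℕ → Fin 4 → K}
    (hc : ∀ k, IsIsolated p (c k).F ∧ Step0 p (c k) (c (k + 1))) (hw : FreeTail.IsWitnessedChain p c j b)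
    (hfloor : ∀ k, ordZero (c k).F ≠ p) {k : ℕ} (hsat : FreeTail.IsSatellite j b k) :
    ∃ oₖ oₖ₁ : ℕ, ordZero (c k).F = oₖ ∧ ordZero (c (k + 1)).F = oₖ₁ ∧ p < oₖ ∧ p < oₖ₁ ∧
      (c (k + 1)).r (j k) = oₖ - p ∧
      (c (k + 2)).r (j k) = oₖ - p ∧ (c (k + 2)).r (j (k + 1)) = oₖ₁ - p ∧
      (∀ k'', k < k'' → k'' < k + 2 → j k'' ≠ j k ∧ b k'' (j k) = 0) ∧
      (∀ k'', k + 1 < k'' → k'' < k + 2 → j k'' ≠ j (k + 1) ∧ b k'' (j (k + 1)) = 0) := by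
  obtain ⟨oₖ, hoₖ, hpoₖ, -⟩ := chain_band p hc hfloor k
  obtain ⟨oₖ₁, hoₖ₁, hpoₖ₁, -⟩ := chain_band p hc hfloor (k + 1)
  have h1 : (c (k + 1)).r = ((c k).r.filter (fun i => b k i = 0)).update (j k) (oₖ - p) := by
    rw [(hw k).2.2.2.2]
    exact step_r_univ' p (j k) (b k) (c k) hoₖ
  have h2 : (c (k + 2)).r =
      ((c (k + 1)).r.filter (fun i => b (k + 1) i = 0)).update (j (k + 1)) (oₖ₁ - p) := by
    show (c (k + 1 + 1)).r = _
    rw [(hw (k + 1)).2.2.2.2]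
    exact step_r_univ' p (j (k + 1)) (b (k + 1)) (c (k + 1)) hoₖ₁
  have hr1 : (c (k + 1)).r (j k) = oₖ - p := by
    rw [h1, Finsupp.coe_update, Function.update_self]
  refine ⟨oₖ, oₖ₁, hoₖ, hoₖ₁, hpoₖ, hpoₖ₁, hr1, ?_, ?_, ?_, ?_⟩
  · rw [h2, Finsupp.coe_update, Function.update_of_ne hsat.1.symm, Finsupp.filter_apply, if_pos hsat.2,
      hr1]
  · rw [h2, Finsupp.coe_update, Function.update_self]
  · intro k'' h1' h2'
    obtain rfl : k'' = k + 1 := by omega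
    exact hsat
  · intro k'' h1' h2'
    exact absurd h1' (by omega)

/-- The satellite pair's multiplicities add up to `oₖ + oₖ₊₁ − 2p` at `c (k+2)`.
[cite: HauserPerlega2019PRIMS, §2] [folklore] -/
theorem satellite_pair_sum (p : ℕ) [Fact p.Prime] [DecidableEq K] {c : ℕ → State K}
    {j : ℕ → Fin 4} {b : ℕ → Fin 4 → K}
    (hc : ∀ k, IsIsolated p (c k).F ∧ Step0 p (c k) (c (k + 1))) (hw : FreeTail.IsWitnessedChain p c j b)
    (hfloor : ∀ k, ordZero (c k).F ≠ p) {k : ℕ} (hsat : FreeTail.IsSatellite j b k) :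
    ∃ oₖ oₖ₁ : ℕ, ordZero (c k).F = oₖ ∧ ordZero (c (k + 1)).F = oₖ₁ ∧ p < oₖ ∧ p < oₖ₁ ∧
      (c (k + 2)).r (j k) + (c (k + 2)).r (j (k + 1)) + 2 * p = oₖ + oₖ₁ := by
  obtain ⟨oₖ, oₖ₁, hoₖ, hoₖ₁, hpoₖ, hpoₖ₁, -, ha, hb, -, -⟩ :=
    stretchBorn_pair_of_satellite p hc hw hfloor hsat
  exact ⟨oₖ, oₖ₁, hoₖ, hoₖ₁, hpoₖ, hpoₖ₁, by rw [ha, hb]; omega⟩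

/-- **Satellite steps recur** on an all-isolated witnessed `Step0 p` chain (the free-tail theorem of
res-dim4-p-5, positive form). [OURS · cites `FreeTailProof.noIsolatedFreeTailAt_self`] -/
theorem exists_satellite_ge (p : ℕ) [Fact p.Prime] [CharP K p] [DecidableEq K] {c : ℕ → State K}
    {j : ℕ → Fin 4} {b : ℕ → Fin 4 → K}
    (hc : ∀ k, IsIsolated p (c k).F ∧ Step0 p (c k) (c (k + 1))) (hw : FreeTail.IsWitnessedChain p c j b)
    (N : ℕ) : ∃ k, N ≤ k ∧ FreeTail.IsSatellite j b k :=
  (FreeTail.satelliteRecurrenceAt_iff_noIsolatedFreeTailAt p p).mpr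
    (FreeTailProof.noIsolatedFreeTailAt_self p) K c j b hw (fun k => (hc k).1) N

/-- **Satellite pairs occur beyond every index**: for every `N` there is a satellite step `k ≥ N`, and there
the two letters `j k ≠ j (k+1)` are both present at `c (k+2)` with `r (j k) + r (j (k+1)) = oₖ + oₖ₊₁ − 2p`,
`oₖ, oₖ₊₁ > p` the two consecutive orders. (K11/(DL) then bounds this sum — sequel.)
[cite: HauserPerlega2019PRIMS, §2] [folklore] -/
theorem frequently_stretchBorn_pair (p : ℕ) [Fact p.Prime] [CharP K p] [DecidableEq K]
    {c : ℕ → State K} {j : ℕ → Fin 4} {b : ℕ → Fin 4 → K}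
    (hc : ∀ k, IsIsolated p (c k).F ∧ Step0 p (c k) (c (k + 1))) (hw : FreeTail.IsWitnessedChain p c j b)
    (hfloor : ∀ k, ordZero (c k).F ≠ p) (N : ℕ) :
    ∃ k, N ≤ k ∧ FreeTail.IsSatellite j b k ∧
      ∃ oₖ oₖ₁ : ℕ, ordZero (c k).F = oₖ ∧ ordZero (c (k + 1)).F = oₖ₁ ∧ p < oₖ ∧ p < oₖ₁ ∧
        (c (k + 2)).r (j k) = oₖ - p ∧ (c (k + 2)).r (j (k + 1)) = oₖ₁ - p ∧
        (c (k + 2)).r (j k) + (c (k + 2)).r (j (k + 1)) + 2 * p = oₖ + oₖ₁ := by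
  obtain ⟨k, hk, hsat⟩ := exists_satellite_ge p hc hw N
  obtain ⟨oₖ, oₖ₁, hoₖ, hoₖ₁, hpoₖ, hpoₖ₁, -, ha, hb, -, -⟩ :=
    stretchBorn_pair_of_satellite p hc hw hfloor hsat
  exact ⟨k, hk, hsat, oₖ, oₖ₁, hoₖ, hoₖ₁, hpoₖ, hpoₖ₁, ha, hb, by rw [ha, hb]; omega⟩

end ResCone

end Summit.ResolutionOfSingularities.ResolutionOfSingularities.Theorems.PIDim4

end
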